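import Summits.BirchSwinnertonDyer.BirchSwinnertonDyer.Theorems.KatoDescentTamePotSupersingularTameUpperOptimalSharpNodesMult
import HarnessLib

/-!
# Route `KatoDescentTamePotSupersingular` (rung K8, sub-rung B4 (t′), cell `bsd-potss`): the UNIT-TWIST ROAD — the upper half at a
# rank-0 (t′) row from the two-split Jetchev reading and named print ONLY, the open-problem input (the LOWER half at a rank-one
# twist = the residual `TameRankOne`) REPLACED by a displayed per-row certificate «`#Ш(E^{(d)})_an` is a `p`-adic unit for ONE
# admissible Heegner twist `d`» (seat `bsd-potss-k8t-c4` g13; route-free; a CERTIFICATE SHAPE, nothing booked, no item closed,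
# BSD is not proved by any of this)

WHY. After today's re-key (`…RoadJ08S2`, `…NodesJ08S2[MD]`, `…TameUpperNonsurjTowerOfNamedFacts`) the U₀-ns node of K8-t′ (item 19202,
parent 19982) rests on named print plus exactly two OPEN nodes: Coates–Sujatha (A) on the residue rows and the residual `TameRankOne`,
the latter entering ONLY as the LOWER half `MissingLowerBoundAt Wd p` at the rank-one Heegner twist `Wd = E^{(d_K)}` of the road's field
(the squeeze over `K`: `ord Ш(E) + ord Ш(E^K) ≤ ord Ш_an(E) + ord Ш_an(E^K)` by Kolyvagin–Jetchev + Gross–Zagier, then the lower half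
at `E^K`). When `#Ш(E^K)_an` is a `p`-adic UNIT that lower half is TRIVIAL. Hence a per-row road with no open-problem input: choose the
Heegner field yourself (instead of Bump–Friedberg–Hoffstein) so that the rank-one twist has `p ∤ #Ш_an` — a NUMERICAL, per-row,
displayed certificate (`hunit`), exactly like the cell's other displayed row data (analytic ranks, Kurihara values). This file states
that road; records instantiate it per row (census of unit twists: kit job, see HOME/k8t-c4/FINDING-19982-twosplit-noL0-k8t-c4-g13.md §8).

References: [Jetchev2008] Thm. 1.4, Cor. 1.5, Rem. 6.2; [MatarNekovar2019] Thm. 0.3, Thm. 0.7, §0.11; [GrossLMS1991] Prop. 3.7 (2), 6.2;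
[GrossZagier1986] I.6.3; [KolyvaginEulerSystems1990] Thm. A; [Manin1972] Cor. 3.6; [EdixhovenManin1991] §1; [Miller2011LMS] Def. 1.1.
-/

set_option autoImplicit false
-- the Theorems directory repeats the summit name (sibling precedent `KatoDescentPotSupersingularAssembly.lean`)
set_option linter.dupNamespace false

noncomputable section

open scoped Classical NumberField

namespace Summit.BirchSwinnertonDyer.BirchSwinnertonDyer.Theorems.TameUpperUnitTwistRoad

open WeierstrassCurve IsDedekindDomain IsDedekindDomain.HeightOneSpectrum NumberField
  Rat.HeightOneSpectrum Literature.NumberTheory.EllipticCurves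
  Literature.NumberTheory.EllipticCurves.ModularForms
  Literature.NumberTheory.DiophantineGeometry
  Literature.NumberTheory.EllipticCurves.Rank1Residual
  Literature.NumberTheory.EllipticCurves.Rank1Residual.Typed
  Literature.NumberTheory.Automorphic Literature.NumberTheory.EllipticCurves.KrizLi2019
  Literature.NumberTheory.QuadraticFields
  Summit.BirchSwinnertonDyer.Rank1Residual
  Summit.BirchSwinnertonDyer.Rank1Residual.Additive
  Summit.BirchSwinnertonDyer.BirchSwinnertonDyer.Theorems
  Summit.BirchSwinnertonDyer.BirchSwinnertonDyer.Theorems.TameUpperHeegnerSharpRoad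

/-! ### §1 The unit-twist road -/

/-- **UNIT-TWIST ROAD (per row, NO open-problem input).** The J08 optimal-curve road over the two-split reading `hJ2`
with (i) the Bump–Friedberg–Hoffstein field replaced by a GIVEN Heegner field `K` (`|d_K| > 4`, every `ℓ ∣ N_E` and `2`
split) together with a GIVEN globally minimal model `Wd` of the twist `E^{(d_K)}` of analytic rank `1` (`hrd`, displayed),
(ii) the L₀ input (`#Ш_an ∈ ℚ`) replaced by Manin–Drinfeld at the datum `D` (tree theorems), and (iii) the LOWER-HALF input
at the twist (the body of the residual `TameRankOne`, an OPEN PROBLEM at an additive potentially supersingular prime)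
replaced by the displayed NUMERICAL certificate `hunit : #Ш(E^{(d_K)})_an ∈ ℚ` with `ord_p ≤ 0` — under which
`MissingLowerBoundAt Wd p` is trivial (`ord_p #Ш_an ≤ 0 ≤ ord_p #Ш`). So at a rank-`0` (t′)/additive row carrying a
lattice-optimal datum with `p ∤ c` and at most one Tamagawa carrier (`hsingle`), the UPPER half `ord_p #Ш(E) ≤ ord_p #Ш(E)_an`
follows from: the schema `hJ2` (⟸ MN19 0.7 + Gross 3.7 (2) + Poitou–Tate + GZ86 III (3.1), k9-c4 g11), Gross–Zagier, Kolyvagin,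
Matar–Nekovář 0.3, GZK, modularity — and the row's displayed data `(K, Wd, hrd, hunit)`. Proof = the road of
`…TameUpperOptimalSharpRoadJ08S2` verbatim otherwise (squeeze `missingUpperBoundAt_tame_rankZero_of_heegnerData_of_lowerTwist_of_sharpIndexBound`).
Conditional on the displayed schema and the named facts; nothing booked; NO item closed; a per-row CERTIFICATE SHAPE for the
U₀-ns rows of items 19202 / 19982 (and, verbatim, for the K9 twin). [cite: Jetchev2008, Thm. 1.4, Cor. 1.5 (p. 3), Rem. 6.2]
[cite: MatarNekovar2019, Thm. 0.3 (p. 456)] [cite: GrossZagier1986, Thm. I.6.3] [cite: KolyvaginEulerSystems1990, Thm. A]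
[cite: Manin1972, Cor. 3.6] [cite: EdixhovenManin1991, §1] [cite: Miller2011LMS, Def. 1.1] -/
theorem missingUpperBoundAt_rankZero_of_optimalDatum_of_jetchev08TwoSplit_of_unitTwist
    (hGZ : ∀ (N : ℕ) [NeZero N] (W : WeierstrassCurve ℚ) (K : Type) [Field K] [NumberField K],
      gross_zagier N W K)
    (hKo : ∀ (N : ℕ) [NeZero N] (W : WeierstrassCurve ℚ) (K : Type) [Field K] [NumberField K],
      kolyvagin N W K)
    (hMN : ∀ (N : ℕ) [NeZero N] (W : WeierstrassCurve ℚ) (K : Type) [Field K] [NumberField K],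
      MatarNekovar2019.thm03_padicValNat_card_sha_le_of_irreducible N W K)
    (hGZK : rank_eq_analyticRank_of_analyticRank_le_one) (hmod : hasEntireLFunction_rat)
    (hJ2 : ∀ (N : ℕ) [NeZero N] (W : WeierstrassCurve ℚ) [W.IsElliptic] [W.IsGloballyMinimal]
      (K : Type) [Field K] [NumberField K],
      IsImaginaryQuadratic K → NumberField.discr K ≠ -3 → NumberField.discr K ≠ -4 →
      SatisfiesHeegnerHypothesis N K → SatisfiesHeegnerHypothesis 2 K →
      ∀ (p : ℕ) [Fact p.Prime], p ≠ 2 → W.analyticRank = 0 → Addv W p → 0 ≤ padicValRat p W.j →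
      ¬ W.HasCM → W.HasIrreducibleModPGaloisRep p →
      ¬ (∀ n : ℕ, W.HasSurjectiveModNGaloisRep (p ^ n : ℕ)) →
      (∃ Dt : ModularParametrizationData W N,
        (∀ z ∈ Dt.L.lattice, ∃ w ∈ periodLattice Dt.f, z = (Dt.c : ℂ) * w) ∧ ¬ (p : ℤ) ∣ Dt.c) →
      ¬ p ∣ (W.baseChange ℚ_[p]).localTamagawaNumber ℤ_[p] →
      (∀ (q' : ℕ) [Fact q'.Prime], q' ∣ N →
        p ∣ (W.baseChange ℚ_[q']).localTamagawaNumber ℤ_[q'] → ¬ q' ^ 2 ∣ N) →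
      ∀ {P : (W.baseChange K).toAffine.Point}, IsHeegnerPoint N W K P → ¬ IsOfFinAddOrder P →
      ∀ (q : ℕ) [Fact q.Prime], q ∣ N → ¬ q ^ 2 ∣ N → q ≠ p →
      padicValNat p (Nat.card (AddCommGroup.primaryComponent (W.baseChange K).sha p)) +
          2 * padicValNat p ((W.baseChange ℚ_[q]).localTamagawaNumber ℤ_[q]) ≤
        2 * padicValNat p (AddSubgroup.zmultiples P).index)
    (W : WeierstrassCurve ℚ) [W.IsElliptic] [W.IsGloballyMinimal] (p : ℕ) [Fact p.Prime]
    [NeZero (W.conductorNorm ℤ)] (hr : W.analyticRank = 0) (hp2 : p ≠ 2) (hadd : Addv W p)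
    (hj : 0 ≤ padicValRat p W.j) (hcm : ¬ W.HasCM) (hirr : W.HasIrreducibleModPGaloisRep p)
    (hns : ¬ (∀ n : ℕ, W.HasSurjectiveModNGaloisRep (p ^ n : ℕ)))
    (hcp : ¬ p ∣ (W.baseChange ℚ_[p]).localTamagawaNumber ℤ_[p])
    (D : ModularParametrizationData W (W.conductorNorm ℤ))
    (hopt : ∀ z ∈ D.L.lattice, ∃ w ∈ periodLattice D.f, z = (D.c : ℂ) * w) (hc : ¬ (p : ℤ) ∣ D.c)
    (hsingle : p ∣ W.tamagawaProduct → ∃ (q : ℕ) (_ : Fact q.Prime), q ∣ W.conductorNorm ℤ ∧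
      ¬ q ^ 2 ∣ W.conductorNorm ℤ ∧ q ≠ p ∧
      padicValNat p W.tamagawaProduct ≤ padicValNat p ((W.baseChange ℚ_[q]).localTamagawaNumber ℤ_[q]))
    (K : Type) [Field K] [NumberField K] (hK : IsImaginaryQuadratic K)
    (hB : 4 < (NumberField.discr K).natAbs) (hHN : SatisfiesHeegnerHypothesis (W.conductorNorm ℤ) K)
    (h2K : SatisfiesHeegnerHypothesis 2 K)
    (Wd : WeierstrassCurve ℚ) [Wd.IsElliptic] [Wd.IsGloballyMinimal] (Cd : VariableChange ℚ)
    (hWd : Cd • W.quadraticTwist (NumberField.discr K : ℚ) = Wd) (hrd : Wd.analyticRank = 1)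
    (hunit : ∃ qd : ℚ, shaAn Wd = (qd : ℂ) ∧ padicValRat p qd ≤ 0) :
    MissingUpperBoundAt W p := by
  have hp : p.Prime := Fact.out
  -- the GIVEN Heegner field: `2` splits (`h2K`), `|d_K| > 4` (`hB`)
  have hodd : Odd (NumberField.discr K) := by
    have h2 : ¬ ((2 : ℕ) : ℤ) ∣ NumberField.discr K :=
      Literature.SatisfiesHeegnerHypothesis.not_dvd_discr hK.1 h2K Nat.prime_two (dvd_refl 2)
    rw [← Int.not_even_iff_odd, even_iff_two_dvd]
    exact_mod_cast h2
  haveI : IsTotallyComplex K := hK.2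
  have hneg : NumberField.discr K < 0 := discr_neg_of_finrank_eq_two K hK.1
  have hdK : NumberField.discr K < -4 := by omega
  have hD3 : NumberField.discr K ≠ -3 := by omega
  have hD4 : NumberField.discr K ≠ -4 := by omega
  -- the Heegner datum and the `K`-rational Heegner point of the OPTIMAL datum `D`
  obtain ⟨β, hβ⟩ := exists_dvd_sq_sub_discr_holds (W.conductorNorm ℤ) K hK hHN
  obtain ⟨H, -⟩ := nonempty_heegnerDatum_holds (W.conductorNorm ℤ) K hK hβ
  obtain ⟨ι⟩ : Nonempty (K →+* ℂ) := inferInstance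
  obtain ⟨P, hP⟩ := heegnerPointComplex_mem_range_map_holds (W.conductorNorm ℤ) W K hK hHN D H ι
  -- the GIVEN globally minimal model `Wd` of the twist, of analytic rank ONE (`hrd`)
  have hD0 : (NumberField.discr K : ℚ) ≠ 0 := by exact_mod_cast NumberField.discr_ne_zero K
  haveI hEt : (W.quadraticTwist (NumberField.discr K : ℚ)).IsElliptic :=
    W.isElliptic_quadraticTwist hD0
  have hrt : (W.quadraticTwist (NumberField.discr K : ℚ)).analyticRank = 1 := by
    rw [← analyticRank_smul _ Cd, hWd]
    exact hrd
  -- rationality of `L(E,1)/Ω(E)`: Manin–Drinfeld at the datum `D` (tree theorems; NO L₀ input)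
  obtain ⟨q0, hq0⟩ : ∃ q0 : ℚ, W.entireLFunction 1 / (W.realPeriodRat : ℂ) = (q0 : ℂ) := by
    obtain ⟨ϖ, -, hϖ, hΩ⟩ := D.exists_rat_mul_realPeriodRat_eq_plusPeriod
    refine ⟨ratPlusSymbol D.f 0 * ϖ, ?_⟩
    have hΩ0 : (W.realPeriodRat : ℂ) ≠ 0 := by exact_mod_cast hΩ.ne'
    rw [div_eq_iff hΩ0, D.isNewformOf.entireLFunction_one_eq, ← hϖ]
    push_cast
    ring
  -- the LOWER half at the twist is TRIVIAL: `#Ш(E^{(d_K)})_an` is a `p`-adic unit (`hunit`)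
  have hlowd : MissingLowerBoundAt Wd p := by
    obtain ⟨qd, hqd, hv⟩ := hunit
    exact ⟨qd, hqd, hv.trans (by exact_mod_cast Nat.zero_le _)⟩
  -- the Heegner point has infinite order (`L(E,1)·L'(E^{(d_K)},1) ≠ 0`, Gross–Zagier)
  have hLt' : (W.quadraticTwist (NumberField.discr K : ℚ)).entireLFunction = Wd.entireLFunction := by
    rw [← hWd, entireLFunction_smul]
  have hLt0 : (W.quadraticTwist (NumberField.discr K : ℚ)).entireLFunction 1 = 0 :=
    entireLFunction_one_eq_zero_of_analyticRank_eq_one hrt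
  obtain ⟨-, hderivd⟩ := leadingLCoeff_eq_deriv_of_analyticRank_eq_one hrd
  have hLW : W.entireLFunction 1 ≠ 0 := (W.analyticRank_eq_zero_iff_holds (hmod W)).1 hr
  have hLK : LDerivEK W K ≠ 0 := by
    rw [AdditivePotMult.lDerivEK_eq_mul_deriv W K hmod hLt0, hLt']
    exact mul_ne_zero hLW hderivd
  have hPH : IsHeegnerPoint (W.conductorNorm ℤ) W K P := ⟨D, H, ι, hP⟩
  have hnt : ¬ IsOfFinAddOrder P :=
    (lDerivEK_ne_zero_iff_not_isOfFinAddOrder W (W.conductorNorm ℤ) K (hGZ _ W K) hK hHN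
      hPH).mp hLK
  -- Kolyvagin: `Ш(E/K)` is finite, so the `p`-primary count is the full count
  obtain ⟨-, hfinK⟩ := (hKo _ W K) hK hHN hPH hnt
  haveI : Finite (W.baseChange K).sha := hfinK
  -- the index bound in PRODUCT form at this datum: ♯ from `hJ2` at the one Tamagawa prime, ♭ from Matar–Nekovář
  have hJ : padicValNat p (Nat.card (W.baseChange K).sha) + 2 * padicValNat p W.tamagawaProduct ≤
      2 * padicValNat p (AddSubgroup.zmultiples P).index := by
    by_cases htam : p ∣ W.tamagawaProduct
    · obtain ⟨q, hqF, hqN, hqsq, hqp, hle⟩ := hsingle htam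
      haveI : Fact q.Prime := hqF
      -- the fact's global Tamagawa binder: the one carrier `q` is `∥ N`; no other bad prime carries `p`
      have htam' : ∀ (q' : ℕ) [Fact q'.Prime], q' ∣ W.conductorNorm ℤ →
          p ∣ (W.baseChange ℚ_[q']).localTamagawaNumber ℤ_[q'] → ¬ q' ^ 2 ∣ W.conductorNorm ℤ := by
        intro q' _ _ hpq'
        by_cases hqq : q' = q
        · subst hqq; exact hqsq
        · exfalso
          have hT0 : W.tamagawaProduct ≠ 0 := W.tamagawaProduct_pos_holds.ne'
          have hcq0 : (W.baseChange ℚ_[q]).localTamagawaNumber ℤ_[q] ≠ 0 :=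
            localTamagawaNumber_padic_ne_zero_holds q (W.baseChange ℚ_[q])
          have hcq'0 : (W.baseChange ℚ_[q']).localTamagawaNumber ℤ_[q'] ≠ 0 :=
            localTamagawaNumber_padic_ne_zero_holds q' (W.baseChange ℚ_[q'])
          have hmul := TameUpperOptimalSharpNodesMult.localTamagawaNumber_padic_mul_dvd_tamagawaProduct W q q' hqq
          have hv : padicValNat p ((W.baseChange ℚ_[q]).localTamagawaNumber ℤ_[q] *
              (W.baseChange ℚ_[q']).localTamagawaNumber ℤ_[q']) ≤ padicValNat p W.tamagawaProduct :=
            (padicValNat_dvd_iff_le hT0).mp (dvd_trans pow_padicValNat_dvd hmul)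
          rw [padicValNat.mul hcq0 hcq'0] at hv
          have h1 : 1 ≤ padicValNat p ((W.baseChange ℚ_[q']).localTamagawaNumber ℤ_[q']) :=
            one_le_padicValNat_of_dvd hcq'0 hpq'
          omega
      -- the two-split reading at the road's field: `2` splits (`h2K`), `d_K ≠ −3, −4` (`|d_K| > 4`)
      have hprim := hJ2 (W.conductorNorm ℤ) W K hK hD3 hD4 hHN h2K p hp2 hr hadd hj hcm hirr hns ⟨D, hopt, hc⟩ hcp
        htam' hPH hnt q hqN hqsq hqp
      have heq : padicValNat p (Nat.card (AddCommGroup.primaryComponent (W.baseChange K).sha p)) =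
          padicValNat p (Nat.card (W.baseChange K).sha) :=
        padicValNat_card_addPrimaryComponent p
      rw [heq] at hprim
      omega
    · have h0 : padicValNat p W.tamagawaProduct = 0 := padicValNat.eq_zero_of_not_dvd htam
      have hMN' := (hMN _ W K) hK hHN hD3 hD4 hPH hnt hp hp2 hirr
      omega
  exact missingUpperBoundAt_tame_rankZero_of_heegnerData_of_lowerTwist_of_sharpIndexBound hp2 hadd hr K D H
    ι P (hGZ _ W K) (hKo _ W K) hGZK hmod hK hHN hodd hdK hP hc Wd Cd hWd hrd q0 hq0 hlowd hJ

end Summit.BirchSwinnertonDyer.BirchSwinnertonDyer.Theorems.TameUpperUnitTwistRoad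

end
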